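import Mathlib
import HarnessLib
import Summits.ValiantsHypothesis.ValiantsHypothesis.Theorems.LacunarySymmetroidMatrixDescartesProductPlusOneCloudMonotone

/-!
# LINE (A) `product_plus_one` (crux `MatrixDescartes`, stmt-ValiantsHypothesis-18050, V1) — W-CB engine: the θ-SHELL
# «`p²·S < θ²S` on a window ⇒ `S` has no three zeros» and the RATE LAWS `θ²ψ₁ − λ²ψ₁ = 6ψ₁²` of binomial rows, `θ²ψ₁ ≥ p²ψ₁` of cloud rows

Owner memo `pub/ideators/val-idea-25/NOTE-idea25g3-18050-LINEA-AB-reduction.md` §19–§22 (val-idea-25 g4, W-CB).  Off the poles the log-Wronskian of a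
`K = 3` company is `W(∏f_j)(x) = −P(x)²·S(x)`, `S = Σ_j ψ₁^{(j)}` (✓ `logWronskian_prod_eq_rowPsi1_sum`; tower `ψ_k = rowPsi_k` of ✓ `…CloudDefs`,
`θψ₁ = ψ₂`, `θψ₂ = ψ₃`, `θ = x·d/dx`, ✓ `hasDerivAt_rowPsi1/2`).  This file replaces the shift `σ` of ✓ `…RealRootedKernel` and the substitution
`y = x^p` of ✓ `…SlowKneeCloudKernel` by ONE disconjugate operator `θ² − p²` (kernel `x^{±p}`):

* §1 ★ `no_three_zeros_of_theta_sq_law` — if `HasDerivAt S (S₁ x/x) x`, `HasDerivAt S₁ (S₂ x/x) x` and `(n+1)²·S x < S₂ x` on `(u,v) ⊂ (0,∞)`, then `S`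
  does not vanish at three points of `(u,v)` (Rolle on `x^{n+1}·S`, then on `((n+1)S + S₁)/x^{n+1}`, whose derivative is `(S₂ − (n+1)²S)/x^{n+2}`);
* §2 the EXACT RATE LAWS of binomial rows (any signs, either side of the root): pair `(d0,d1)` (`C = 0`, rate `p = e₁+1`): `ψ₃ − p²ψ₁ = 6ψ₁²`;
  pair `(d0,d2)` (`B = 0`, rate `q = e₁+e₂+2`): `ψ₃ − q²ψ₁ = 6ψ₁²`; pair `(d1,d2)` (`A = 0`, rate `q − p = e₂+1`): `ψ₃ − (q−p)²ψ₁ = 6ψ₁²` (the closed forms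
  and signs of `ψ₁` — pole `> 0`, knee `< 0` — are ✓ `pair01_rowPsi1_eq` / `knee_rowPsi1_eq` / `pair12_rowPsi1_eq` and ✓ `pair01_pole_rowPsi1_pos` … of
  `…OneBump` / `…SlopeKnee`, cited by the cell file, not restated here);
* §3 the CLOUD LAW: an unswitched incoherent row (`B, C ≥ 0`, `u > 0`) has `p²ψ₁ ≤ ψ₃` for EVERY `p < q` — no gap condition — strictly if `B + C > 0`
  (certificate `ψ₃ − p²ψ₁ = q²(q²−p²)γ·u + (3H₁H₃ + 3H₂² + q(q²−p²)γH₁)·u² + 12H₁²H₂·u³ + 6H₁⁴·u⁴`).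

Consequence (next file `…SlowKneeCellRateFree`): the slow-knee cloud cell holds WITHOUT the gap hypothesis and with binomial POLES of all three pairs
added.  Honest framing: calculus of one W-cell; NOT `WronskianBudgetK3` / `OneChangeFloorK3` / `stub_classRowK3` / `stub_polyLaw` / `MatrixDescartes` / B;
`VP ≠ VNP` NOT proved.  No definitions, no named facts; Mathlib + ✓ `…CloudDefs` / `…CloudCalculus` / `…CloudMonotone` only.
-/

set_option linter.dupNamespace false

namespace Summit.ValiantsHypothesis.ValiantsHypothesis.Theorems.LacunarySymmetroidMatrixDescartes

namespace ProductPlusOne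

open Set
open scoped Topology

/-! ### §1 The θ-shell: `(n+1)²·S < θ²S` forbids three zeros -/

/-- ★ **THE θ-SHELL.**  On a window `(u,v)` with `0 ≤ u`, let `S` have θ-derivatives `S₁`, `S₂` in the form `HasDerivAt S (S₁ x / x) x`,
`HasDerivAt S₁ (S₂ x / x) x`, and suppose the RATE LAW `(n+1)²·S x < S₂ x` there.  Then `S` does not vanish at three points `x₁ < x₂ < x₃` of
`(u,v)` (the operator `θ² − (n+1)²` has kernel `x^{±(n+1)}`: Rolle for `x^{n+1}·S`, then for `((n+1)·S + S₁)/x^{n+1}`). [this file's theorem] -/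
theorem no_three_zeros_of_theta_sq_law (n : ℕ) {S S₁ S₂ : ℝ → ℝ} {u v : ℝ} (hu : 0 ≤ u)
    (hS : ∀ x ∈ Ioo u v, HasDerivAt S (S₁ x / x) x) (hS₁ : ∀ x ∈ Ioo u v, HasDerivAt S₁ (S₂ x / x) x)
    (hlaw : ∀ x ∈ Ioo u v, ((n : ℝ) + 1) ^ 2 * S x < S₂ x)
    {x₁ x₂ x₃ : ℝ} (h₁ : x₁ ∈ Ioo u v) (h₃ : x₃ ∈ Ioo u v) (h12 : x₁ < x₂) (h23 : x₂ < x₃)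
    (hz₁ : S x₁ = 0) (hz₂ : S x₂ = 0) (hz₃ : S x₃ = 0) : False := by
  have h₂ : x₂ ∈ Ioo u v := ⟨h₁.1.trans h12, h23.trans h₃.2⟩
  have hpos : ∀ x ∈ Ioo u v, 0 < x := fun x hx => hu.trans_lt hx.1
  -- first Rolle function `F₁ = x^{n+1}·S`, derivative `x^n·((n+1)S + S₁)`
  have hF₁ : ∀ x ∈ Ioo u v, HasDerivAt (fun t : ℝ => t ^ (n + 1) * S t) (x ^ n * (((n : ℝ) + 1) * S x + S₁ x)) x := by
    intro x hx
    have hx0 : x ≠ 0 := (hpos x hx).ne'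
    have hp : HasDerivAt (fun t : ℝ => t ^ (n + 1)) (((n + 1 : ℕ) : ℝ) * x ^ n) x := by
      simpa using hasDerivAt_pow (n + 1) x
    refine (hp.mul (hS x hx)).congr_deriv ?_
    push_cast
    rw [pow_succ]
    field_simp
  -- second Rolle function `F₂ = ((n+1)S + S₁)/x^{n+1}`, derivative `(S₂ − (n+1)²S)/x^{n+2}`
  have hF₂ : ∀ x ∈ Ioo u v, HasDerivAt (fun t : ℝ => (((n : ℝ) + 1) * S t + S₁ t) / t ^ (n + 1))
      ((S₂ x - ((n : ℝ) + 1) ^ 2 * S x) / x ^ (n + 2)) x := by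
    intro x hx
    have hx0 : x ≠ 0 := (hpos x hx).ne'
    have hN : HasDerivAt (fun t : ℝ => ((n : ℝ) + 1) * S t + S₁ t) (((n : ℝ) + 1) * (S₁ x / x) + S₂ x / x) x :=
      ((hS x hx).const_mul _).add (hS₁ x hx)
    have hp : HasDerivAt (fun t : ℝ => t ^ (n + 1)) (((n + 1 : ℕ) : ℝ) * x ^ n) x := by
      simpa using hasDerivAt_pow (n + 1) x
    refine (hN.div hp (pow_ne_zero _ hx0)).congr_deriv ?_
    push_cast
    rw [pow_succ, pow_succ, pow_succ]
    field_simp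
    ring
  -- Rolle twice
  have hcont₁ : ∀ a b, Icc a b ⊆ Ioo u v → ContinuousOn (fun t : ℝ => t ^ (n + 1) * S t) (Icc a b) :=
    fun a b hab x hx => (hF₁ x (hab hx)).continuousAt.continuousWithinAt
  have hsub12 : Icc x₁ x₂ ⊆ Ioo u v := fun t ht => ⟨h₁.1.trans_le ht.1, ht.2.trans_lt h₂.2⟩
  have hsub23 : Icc x₂ x₃ ⊆ Ioo u v := fun t ht => ⟨h₂.1.trans_le ht.1, ht.2.trans_lt h₃.2⟩
  obtain ⟨c₁, hc₁, hc₁'⟩ := exists_hasDerivAt_eq_zero h12 (hcont₁ _ _ hsub12) (by simp [hz₁, hz₂])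
    (fun t ht => hF₁ t (hsub12 (Ioo_subset_Icc_self ht)))
  obtain ⟨c₂, hc₂, hc₂'⟩ := exists_hasDerivAt_eq_zero h23 (hcont₁ _ _ hsub23) (by simp [hz₂, hz₃])
    (fun t ht => hF₁ t (hsub23 (Ioo_subset_Icc_self ht)))
  have hc₁I : c₁ ∈ Ioo u v := hsub12 (Ioo_subset_Icc_self hc₁)
  have hc₂I : c₂ ∈ Ioo u v := hsub23 (Ioo_subset_Icc_self hc₂)
  have hN₁ : ((n : ℝ) + 1) * S c₁ + S₁ c₁ = 0 :=
    (mul_eq_zero.1 hc₁').resolve_left (pow_ne_zero _ (hpos c₁ hc₁I).ne')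
  have hN₂ : ((n : ℝ) + 1) * S c₂ + S₁ c₂ = 0 :=
    (mul_eq_zero.1 hc₂').resolve_left (pow_ne_zero _ (hpos c₂ hc₂I).ne')
  have hc12 : c₁ < c₂ := hc₁.2.trans hc₂.1
  have hsub : Icc c₁ c₂ ⊆ Ioo u v := fun t ht => ⟨hc₁I.1.trans_le ht.1, ht.2.trans_lt hc₂I.2⟩
  have hcont₂ : ContinuousOn (fun t : ℝ => (((n : ℝ) + 1) * S t + S₁ t) / t ^ (n + 1)) (Icc c₁ c₂) :=
    fun x hx => (hF₂ x (hsub hx)).continuousAt.continuousWithinAt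
  obtain ⟨c, hc, hc'⟩ := exists_hasDerivAt_eq_zero hc12 hcont₂ (by simp [hN₁, hN₂])
    (fun t ht => hF₂ t (hsub (Ioo_subset_Icc_self ht)))
  have hcI : c ∈ Ioo u v := hsub (Ioo_subset_Icc_self hc)
  have hnum : S₂ c - ((n : ℝ) + 1) ^ 2 * S c = 0 :=
    (div_eq_zero_iff.1 hc').resolve_right (pow_ne_zero _ (hpos c hcI).ne')
  have := hlaw c hcI
  linarith

/-! ### §2 The exact rate laws of binomial rows -/

section Row

variable (e₁ e₂ : ℕ) (A B C : ℝ)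

/-- Pair `(d0,d1)`: **the rate law `ψ₃ − p²ψ₁ = 6ψ₁²`** (pure identity in the tower, any signs of `A, B`). [this file's lemma] -/
theorem pair01_rowPsi3_law (x : ℝ) :
    rowPsi3 e₁ e₂ A B 0 x - ((e₁ : ℝ) + 1) ^ 2 * rowPsi1 e₁ e₂ A B 0 x = 6 * rowPsi1 e₁ e₂ A B 0 x ^ 2 := by
  unfold rowPsi3 rowPsi1 rowH
  ring

/-- Pair `(d0,d2)`: **the rate law `ψ₃ − q²ψ₁ = 6ψ₁²`**. [this file's lemma] -/
theorem pair02_rowPsi3_law (x : ℝ) :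
    rowPsi3 e₁ e₂ A 0 C x - ((e₁ : ℝ) + e₂ + 2) ^ 2 * rowPsi1 e₁ e₂ A 0 C x = 6 * rowPsi1 e₁ e₂ A 0 C x ^ 2 := by
  unfold rowPsi3 rowPsi1 rowH
  ring

/-- Pair `(d1,d2)`: **the rate law `ψ₃ − (q−p)²ψ₁ = 6ψ₁²`** (uses `u·(−Bx^p − Cx^q) = 1`). [this file's lemma] -/
theorem pair12_rowPsi3_law {x : ℝ} (hF : (0 : ℝ) - B * x ^ (e₁ + 1) - C * x ^ (e₁ + e₂ + 2) ≠ 0) :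
    rowPsi3 e₁ e₂ 0 B C x - ((e₂ : ℝ) + 1) ^ 2 * rowPsi1 e₁ e₂ 0 B C x = 6 * rowPsi1 e₁ e₂ 0 B C x ^ 2 := by
  unfold rowPsi3 rowPsi1 rowH rowU
  field_simp
  ring

/-! ### §3 The cloud law `p²ψ₁ ≤ ψ₃` (no gap condition) -/

/-- The cloud certificate: `ψ₃ − p²ψ₁ = q²(q²−p²)γ·u + (3H₁H₃ + 3H₂² + q(q²−p²)γ·H₁)·u² + 12H₁²H₂·u³ + 6H₁⁴·u⁴`
(`q² − p² = (e₂+1)(2e₁+e₂+3)`). [this file's lemma] -/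
theorem rowPsi3_sub_sq_mul_rowPsi1_eq (x : ℝ) :
    rowPsi3 e₁ e₂ A B C x - ((e₁ : ℝ) + 1) ^ 2 * rowPsi1 e₁ e₂ A B C x
      = ((e₁ : ℝ) + e₂ + 2) ^ 2 * (((e₂ : ℝ) + 1) * (2 * (e₁ : ℝ) + e₂ + 3)) * (C * x ^ (e₁ + e₂ + 2)) * rowU e₁ e₂ A B C x
        + (3 * rowH e₁ e₂ 1 B C x * rowH e₁ e₂ 3 B C x + 3 * rowH e₁ e₂ 2 B C x ^ 2
            + ((e₁ : ℝ) + e₂ + 2) * (((e₂ : ℝ) + 1) * (2 * (e₁ : ℝ) + e₂ + 3)) * (C * x ^ (e₁ + e₂ + 2)) * rowH e₁ e₂ 1 B C x)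
          * rowU e₁ e₂ A B C x ^ 2
        + 12 * rowH e₁ e₂ 1 B C x ^ 2 * rowH e₁ e₂ 2 B C x * rowU e₁ e₂ A B C x ^ 3
        + 6 * rowH e₁ e₂ 1 B C x ^ 4 * rowU e₁ e₂ A B C x ^ 4 := by
  unfold rowPsi3 rowPsi1 rowH
  ring

/-- ★ **THE CLOUD LAW** (every `p < q`, no gap condition): an unswitched incoherent row (`B, C ≥ 0`, `0 < A − Bx^p − Cx^q`, `x > 0`) has
`p²·ψ₁ ≤ ψ₃`. [this file's lemma] -/
theorem cloud_rowPsi3_ge {x : ℝ} (hx : 0 < x) (hB : 0 ≤ B) (hC : 0 ≤ C) (hF : 0 < A - B * x ^ (e₁ + 1) - C * x ^ (e₁ + e₂ + 2)) :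
    ((e₁ : ℝ) + 1) ^ 2 * rowPsi1 e₁ e₂ A B C x ≤ rowPsi3 e₁ e₂ A B C x := by
  have hu := rowU_pos e₁ e₂ A B C hF
  have h1 := rowH_nonneg e₁ e₂ B C 1 hx hB hC
  have h2 := rowH_nonneg e₁ e₂ B C 2 hx hB hC
  have h3 := rowH_nonneg e₁ e₂ B C 3 hx hB hC
  have hγ : 0 ≤ C * x ^ (e₁ + e₂ + 2) := mul_nonneg hC (pow_pos hx _).le
  rw [← sub_nonneg, rowPsi3_sub_sq_mul_rowPsi1_eq]
  positivity

/-- ★ **THE CLOUD LAW, strict**: if moreover `B + C > 0` then `p²·ψ₁ < ψ₃`. [this file's lemma] -/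
theorem cloud_rowPsi3_gt {x : ℝ} (hx : 0 < x) (hB : 0 ≤ B) (hC : 0 ≤ C) (hBC : 0 < B + C)
    (hF : 0 < A - B * x ^ (e₁ + 1) - C * x ^ (e₁ + e₂ + 2)) :
    ((e₁ : ℝ) + 1) ^ 2 * rowPsi1 e₁ e₂ A B C x < rowPsi3 e₁ e₂ A B C x := by
  have hu := rowU_pos e₁ e₂ A B C hF
  have h1 := rowH_one_pos e₁ e₂ B C hx hB hC hBC
  have h2 := rowH_nonneg e₁ e₂ B C 2 hx hB hC
  have h3 := rowH_nonneg e₁ e₂ B C 3 hx hB hC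
  have hγ : 0 ≤ C * x ^ (e₁ + e₂ + 2) := mul_nonneg hC (pow_pos hx _).le
  rw [← sub_pos, rowPsi3_sub_sq_mul_rowPsi1_eq]
  positivity

end Row

end ProductPlusOne

end Summit.ValiantsHypothesis.ValiantsHypothesis.Theorems.LacunarySymmetroidMatrixDescartes
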